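import Mathlib
import HarnessLib
import Summits.NavierStokesRegularity.NavierStokesRegularity.Theorems.LocalSineTubeDoorProfileAlignedWindowRigidityAncient
import Literature.Analysis.FluidPDE.OseenZoomCovariance

/-!
# Route `PoloidalWindowDoor`, crux `PoloidalWindowRigidity` (stmt-19708), line `congruence_door` (cstrat-19708 g4) —
# STUB G0, THE CONGRUENCE DOOR, PROVED

Seat ns-poloidal-K2-p2 g7 (interim LEAD-of-record on 19708; file `--supports 19708`).  The registered stub `stub_congruenceDoor`
of `Cruxes/PoloidalWindowRigidity/Lines/congruence_door.lean` (v1, skeleton 910287566cb5196e), VERBATIM (name and statement) as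
`stub_congruenceDoor` below: a profile `v` of the route's Type-I ancient mild class (`HasTypeITimeDecay C v`, continuity on the backward
slab, unit-viscosity Oseen-mild between negative times) two of whose slices `s < t < 0` are CONGRUENT by a Euclidean motion on a
nonempty open set, `v t x = A (v s (A⁻¹(x − b)))` for `x ∈ O`, is not backward-singular at the apex.

Proof (the card's, all inputs in the tree): (1) slices of class profiles are real-analytic on `ℝ³`
(`…ProfileAlignedWindowRigidityAncient.analyticOnNhd_uncurry`), so the congruence holds for every `x` (identity theorem on the
connected `ℝ³`); (2) with `δ = t − s > 0`, the time-translate `u₁ τ = v (τ + δ)` and the push-forward `u₂ τ x = A (v τ (A⁻¹(x − b)))`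
are bounded measurable solutions on `(s, T)` (any `T` with `T + δ < 0`) of the SAME Oseen integral equation
`w τ = e^{(τ−s)Δ} v(t) − B¹_s(w, w)(τ)` — by `oseenDuhamel_translate` (time covariance), `oseenDuhamel_symm_conj_linearIsometryEquiv` +
`oseenDuhamel_comp_add_right` and `heatExtension_conj_linearIsometryEquiv` + `heatExtension_comp_add_right` (Euclidean covariance);
FORWARD uniqueness `Literature.Analysis.FluidPDE.oseenMild_bounded_unique` and slice continuity give `v (τ + δ) x = A (v τ (A⁻¹(x − b)))`
for all `τ ∈ (s, −δ)`, all `x`; (3) hence `‖v t' x‖ ≤ |C|/√δ` for `t' ∈ (t, 0)` (Type-I bound one period earlier); (4) on the parabolic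
cylinder `Q_r(0,0)`, `r = √(−t)`, `‖v‖_{L^∞} < ∞`, contradicting `IsBackwardSingularPoint v 0`.  No backward uniqueness, no decay,
no poloidality; mildness is used twice (analyticity, forward uniqueness) — honours `…Negative.poloidalWindowRigidity_false_without_mild`.

WHAT THIS IS NOT: not the crux and not a claim about Navier–Stokes regularity — the class lemma G0 of the line `congruence_door`
(bears_on LADDER-NS N0 via crux 19708); the research stubs G1–G3 of that line are untouched.
-/

noncomputable section

-- the summit and its single sub-problem share the name (CONVENTIONS §1), as in every Theorems file
set_option linter.dupNamespace false

namespace Summit.NavierStokesRegularity.NavierStokesRegularity.Theorems.PoloidalWindowDoorPoloidalWindowRigidityCongruenceDoor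

open Set Function Filter Topology Metric MeasureTheory
open scoped RealInnerProductSpace InnerProductSpace ENNReal
open Literature.Analysis Literature.Analysis.FluidPDE
open Summit.NavierStokesRegularity.NavierStokesRegularity.Theorems.LocalSineTubeDoorProfileAlignedWindowRigidityAncient

/-- **Forward propagation of a slice congruence.**  For a class profile `v` with `v t = A ∘ v s ∘ (A⁻¹(· − b))` on ALL of `ℝ³`
(`s < t`, `A` a linear isometry), the congruence propagates forward: `v (τ + (t − s)) x = A (v τ (A⁻¹(x − b)))` for every
`τ ∈ (s, s − t)` (i.e. `τ + (t−s) < 0`) and every `x` — forward uniqueness of bounded Oseen-mild solutions applied to the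
time-translate and the push-forward, which solve the same integral equation from time `s`. [folklore] -/
theorem congruence_propagates {C : ℝ} {v : ℝ → EuclideanSpace ℝ (Fin 3) → EuclideanSpace ℝ (Fin 3)}
    (hrate : HasTypeITimeDecay C v) (hcont : ContinuousOn (uncurry v) (Iio (0 : ℝ) ×ˢ univ))
    (hmild : ∀ s t : ℝ, s < t → t < 0 → ∀ x,
      v t x = UnboundedOperators.heatExtension (v s) (t - s) x - oseenDuhamel 1 s v v t x)
    {s t : ℝ} (hst : s < t) (A : EuclideanSpace ℝ (Fin 3) ≃ₗᵢ[ℝ] EuclideanSpace ℝ (Fin 3))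
    (b : EuclideanSpace ℝ (Fin 3)) (hcong : ∀ x, v t x = A (v s (A.symm (x - b))))
    {τ : ℝ} (hτs : s < τ) (hτ : τ + (t - s) < 0) (x : EuclideanSpace ℝ (Fin 3)) :
    v (τ + (t - s)) x = A (v τ (A.symm (x - b))) := by
  set δ : ℝ := t - s with hδ
  have hδ0 : 0 < δ := by rw [hδ]; linarith
  -- the comparison interval `(s, T)` with `τ < T`, `T + δ < 0`
  set T : ℝ := (τ + δ) / 2 - δ with hT
  have hτT : τ < T := by rw [hT]; linarith
  have hTδ : T + δ < 0 := by rw [hT]; linarith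
  have hT0 : T < 0 := by linarith
  have hsT : s < T := hτs.trans hτT
  -- the two fields
  set u₁ : ℝ → EuclideanSpace ℝ (Fin 3) → EuclideanSpace ℝ (Fin 3) := fun σ => v (σ + δ) with hu₁
  set u₂ : ℝ → EuclideanSpace ℝ (Fin 3) → EuclideanSpace ℝ (Fin 3) :=
    fun σ y => A (v σ (A.symm (y + -b))) with hu₂
  set U : ℝ → EuclideanSpace ℝ (Fin 3) → EuclideanSpace ℝ (Fin 3) :=
    fun σ y => UnboundedOperators.heatExtension (v t) (σ - s) y with hU
  have hcong' : ∀ y, v t y = A (v s (A.symm (y + -b))) := fun y => by rw [← sub_eq_add_neg]; exact hcong y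
  -- ## (a) both solve `w σ = U σ - B¹_s(w,w)(σ)` on `(s, T)`
  have hm₁ : ∀ σ ∈ Ioo s T, u₁ σ =ᵐ[volume] fun y => U σ y - oseenDuhamel 1 s u₁ u₁ σ y := by
    intro σ hσ
    refine Eventually.of_forall fun y => ?_
    have h1 : s + δ < σ + δ := by linarith [hσ.1]
    have h2 : σ + δ < 0 := by linarith [hσ.2]
    have h := hmild (s + δ) (σ + δ) h1 h2 y
    have e1 : s + δ = t := by rw [hδ]; ring
    have e2 : σ + δ - (s + δ) = σ - s := by ring
    rw [e2, e1] at h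
    rw [hu₁, hU]
    dsimp only
    rw [h, oseenDuhamel_translate 1 s δ v v σ y, e1]
  have hm₂ : ∀ σ ∈ Ioo s T, u₂ σ =ᵐ[volume] fun y => U σ y - oseenDuhamel 1 s u₂ u₂ σ y := by
    intro σ hσ
    refine Eventually.of_forall fun y => ?_
    have hσ0 : σ < 0 := hσ.2.trans hT0
    have h := hmild s σ hσ.1 hσ0 (A.symm (y + -b))
    rw [hu₂, hU]
    dsimp only
    rw [h, map_sub]
    -- free part
    have hfree : A (UnboundedOperators.heatExtension (v s) (σ - s) (A.symm (y + -b))) =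
        UnboundedOperators.heatExtension (v t) (σ - s) y := by
      rw [← heatExtension_conj_linearIsometryEquiv A (v s) (σ - s) (y + -b),
        ← heatExtension_comp_add_right (fun z => A (v s (A.symm z))) (-b) (σ - s) y]
      congr 1
      funext z
      exact (hcong' z).symm
    -- Duhamel part
    have hduh : A (oseenDuhamel 1 s v v σ (A.symm (y + -b))) =
        oseenDuhamel 1 s (fun σ' z => A (v σ' (A.symm (z + -b)))) (fun σ' z => A (v σ' (A.symm (z + -b)))) σ y := by
      have h1 := oseenDuhamel_symm_conj_linearIsometryEquiv A.symm 1 s v v σ (y + -b)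
      simp only [LinearIsometryEquiv.symm_symm] at h1
      rw [← h1, ← oseenDuhamel_comp_add_right 1 s (fun σ' z => A (v σ' (A.symm z))) (fun σ' z => A (v σ' (A.symm z))) (-b) σ y]
    rw [hfree, hduh]
  -- ## (b) bounds and measurability on `(s, T)`
  set M : ℝ := |C| / Real.sqrt (-(T + δ)) + |C| / Real.sqrt (-T) with hM
  have hMa : 0 ≤ |C| / Real.sqrt (-(T + δ)) := div_nonneg (abs_nonneg C) (Real.sqrt_nonneg _)
  have hMb : 0 ≤ |C| / Real.sqrt (-T) := div_nonneg (abs_nonneg C) (Real.sqrt_nonneg _)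
  have hM0 : 0 ≤ M := add_nonneg hMa hMb
  have hrate' : ∀ σ < 0, ∀ y, ‖v σ y‖ ≤ |C| / Real.sqrt (-σ) := fun σ hσ y =>
    (hrate σ hσ y).trans (div_le_div_of_nonneg_right (le_abs_self C) (Real.sqrt_nonneg _))
  have hb₁ : ∀ σ ∈ Ioo s T, ∀ y, ‖u₁ σ y‖ ≤ M := by
    intro σ hσ y
    have h2 : σ + δ < 0 := by linarith [hσ.2]
    have hle : Real.sqrt (-(T + δ)) ≤ Real.sqrt (-(σ + δ)) := Real.sqrt_le_sqrt (by linarith [hσ.2])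
    have hpos : 0 < Real.sqrt (-(T + δ)) := Real.sqrt_pos.2 (by linarith)
    calc ‖u₁ σ y‖ = ‖v (σ + δ) y‖ := by rw [hu₁]
      _ ≤ |C| / Real.sqrt (-(σ + δ)) := hrate' _ h2 y
      _ ≤ |C| / Real.sqrt (-(T + δ)) := div_le_div_of_nonneg_left (abs_nonneg C) hpos hle
      _ ≤ M := le_add_of_nonneg_right hMb
  have hb₂ : ∀ σ ∈ Ioo s T, ∀ y, ‖u₂ σ y‖ ≤ M := by
    intro σ hσ y
    have hσ0 : σ < 0 := hσ.2.trans hT0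
    have hle : Real.sqrt (-T) ≤ Real.sqrt (-σ) := Real.sqrt_le_sqrt (by linarith [hσ.2])
    have hpos : 0 < Real.sqrt (-T) := Real.sqrt_pos.2 (by linarith)
    calc ‖u₂ σ y‖ = ‖v σ (A.symm (y + -b))‖ := by rw [hu₂]; exact A.norm_map _
      _ ≤ |C| / Real.sqrt (-σ) := hrate' _ hσ0 _
      _ ≤ |C| / Real.sqrt (-T) := div_le_div_of_nonneg_left (abs_nonneg C) hpos hle
      _ ≤ M := le_add_of_nonneg_left hMa
  have hmeasI : MeasurableSet (Ioo s T ×ˢ (univ : Set (EuclideanSpace ℝ (Fin 3)))) :=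
    measurableSet_Ioo.prod MeasurableSet.univ
  have hc₁ : ContinuousOn (uncurry u₁) (Ioo s T ×ˢ univ) := by
    have hφ : Continuous fun p : ℝ × EuclideanSpace ℝ (Fin 3) => ((p.1 + δ, p.2) : ℝ × EuclideanSpace ℝ (Fin 3)) := by
      fun_prop
    have hmaps : MapsTo (fun p : ℝ × EuclideanSpace ℝ (Fin 3) => ((p.1 + δ, p.2) : ℝ × EuclideanSpace ℝ (Fin 3)))
        (Ioo s T ×ˢ univ) (Iio (0 : ℝ) ×ˢ univ) := by
      rintro ⟨σ, y⟩ ⟨hσ, -⟩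
      exact ⟨show σ + δ < 0 by have := (mem_Ioo.1 hσ).2; linarith, mem_univ _⟩
    have h := hcont.comp hφ.continuousOn hmaps
    refine h.congr fun p _ => ?_
    obtain ⟨σ, y⟩ := p; rfl
  have hc₂ : ContinuousOn (uncurry u₂) (Ioo s T ×ˢ univ) := by
    have hφ : Continuous fun p : ℝ × EuclideanSpace ℝ (Fin 3) =>
        ((p.1, A.symm (p.2 + -b)) : ℝ × EuclideanSpace ℝ (Fin 3)) := by fun_prop
    have hmaps : MapsTo (fun p : ℝ × EuclideanSpace ℝ (Fin 3) => ((p.1, A.symm (p.2 + -b)) : ℝ × EuclideanSpace ℝ (Fin 3)))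
        (Ioo s T ×ˢ univ) (Iio (0 : ℝ) ×ˢ univ) := by
      rintro ⟨σ, y⟩ ⟨hσ, -⟩
      exact ⟨show σ < 0 from (mem_Ioo.1 hσ).2.trans hT0, mem_univ _⟩
    have h := (A.continuous.comp_continuousOn (hcont.comp hφ.continuousOn hmaps))
    refine h.congr fun p _ => ?_
    obtain ⟨σ, y⟩ := p; rfl
  have hmeas₁ : AEStronglyMeasurable (uncurry u₁) ((volume : Measure (ℝ × EuclideanSpace ℝ (Fin 3))).restrict (Ioo s T ×ˢ univ)) :=
    hc₁.aestronglyMeasurable hmeasI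
  have hmeas₂ : AEStronglyMeasurable (uncurry u₂) ((volume : Measure (ℝ × EuclideanSpace ℝ (Fin 3))).restrict (Ioo s T ×ˢ univ)) :=
    hc₂.aestronglyMeasurable hmeasI
  -- ## (c) forward uniqueness on `(s, T)` and continuity in `x`
  have huniq := oseenMild_bounded_unique (u := u₁) (v := u₂) (U := U) one_pos hM0 hmeas₁ hmeas₂ hb₁ hb₂ hm₁ hm₂ τ ⟨hτs, hτT⟩
  have hτ0 : τ < 0 := hτT.trans hT0
  have hcu₁ : Continuous (u₁ τ) := by
    have h : ContinuousOn (uncurry u₁) (Ioo s T ×ˢ univ) := hc₁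
    have hφ : Continuous fun y : EuclideanSpace ℝ (Fin 3) => ((τ, y) : ℝ × EuclideanSpace ℝ (Fin 3)) := by fun_prop
    have h2 := h.comp_continuous hφ fun y => ⟨⟨hτs, hτT⟩, mem_univ y⟩
    simpa [Function.comp_def] using h2
  have hcu₂ : Continuous (u₂ τ) := by
    have h : ContinuousOn (uncurry u₂) (Ioo s T ×ˢ univ) := hc₂
    have hφ : Continuous fun y : EuclideanSpace ℝ (Fin 3) => ((τ, y) : ℝ × EuclideanSpace ℝ (Fin 3)) := by fun_prop
    have h2 := h.comp_continuous hφ fun y => ⟨⟨hτs, hτT⟩, mem_univ y⟩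
    simpa [Function.comp_def] using h2
  have heq : u₁ τ = u₂ τ := (Continuous.ae_eq_iff_eq volume hcu₁ hcu₂).1 huniq
  have h := congrFun heq x
  rw [hu₁, hu₂] at h
  dsimp only at h
  rw [← sub_eq_add_neg] at h
  exact h

/-- **THE CONGRUENCE DOOR (stub G0 of the line `congruence_door`, VERBATIM).**  A profile of the route's Type-I ancient mild
class two of whose slices `s < t < 0` are congruent by a Euclidean motion on a nonempty open set is not backward-singular at
the apex. [folklore] -/
theorem stub_congruenceDoor :
    ∀ (C : ℝ) (v : ℝ → EuclideanSpace ℝ (Fin 3) → EuclideanSpace ℝ (Fin 3)),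
      Literature.Analysis.FluidPDE.HasTypeITimeDecay C v →
      ContinuousOn (Function.uncurry v) (Set.Iio (0 : ℝ) ×ˢ Set.univ) →
      (∀ s t : ℝ, s < t → t < 0 → ∀ x, v t x =
        Literature.Analysis.UnboundedOperators.heatExtension (v s) (t - s) x -
          Literature.Analysis.FluidPDE.oseenDuhamel 1 s v v t x) →
      (∃ s t : ℝ, s < t ∧ t < 0 ∧
          ∃ (A : EuclideanSpace ℝ (Fin 3) ≃ₗᵢ[ℝ] EuclideanSpace ℝ (Fin 3)) (b : EuclideanSpace ℝ (Fin 3))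
            (O : Set (EuclideanSpace ℝ (Fin 3))), IsOpen O ∧ O.Nonempty ∧ ∀ x ∈ O, v t x = A (v s (A.symm (x - b)))) →
      ¬ Literature.Analysis.FluidPDE.IsBackwardSingularPoint v 0 := by
  intro C v hrate hcont hmild ⟨s, t, hst, ht0, A, b, O, hO, ⟨x₀, hx₀⟩, hcongO⟩ hsing
  have hs0 : s < 0 := hst.trans ht0
  -- ## (1) the congruence holds on all of `ℝ³` (slice analyticity + identity theorem)
  have han : AnalyticOnNhd ℝ (uncurry v) (Iio (0 : ℝ) ×ˢ univ) :=
    analyticOnNhd_uncurry hcont (bdd_of_hasTypeITimeDecay hrate) hmild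
  have hslice : ∀ σ < 0, AnalyticOnNhd ℝ (v σ) univ := by
    intro σ hσ y _
    have h := (han (σ, y) ⟨hσ, mem_univ y⟩).comp
      (analyticAt_const.prod analyticAt_id : AnalyticAt ℝ (fun z : EuclideanSpace ℝ (Fin 3) => ((σ, z) : ℝ × _)) y)
    simpa [Function.comp_def] using h
  have hrhs : AnalyticOnNhd ℝ (fun x => A (v s (A.symm (x - b)))) univ := by
    intro y _
    have hψ : AnalyticAt ℝ (fun x : EuclideanSpace ℝ (Fin 3) => A.symm (x - b)) y :=
      (A.symm.toContinuousLinearEquiv : EuclideanSpace ℝ (Fin 3) →L[ℝ] EuclideanSpace ℝ (Fin 3)).analyticAt _ |>.comp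
        (analyticAt_id.sub analyticAt_const)
    have h1 : AnalyticAt ℝ (fun x : EuclideanSpace ℝ (Fin 3) => v s (A.symm (x - b))) y :=
      (hslice s hs0 _ (mem_univ _)).comp hψ
    exact ((A.toContinuousLinearEquiv : EuclideanSpace ℝ (Fin 3) →L[ℝ] EuclideanSpace ℝ (Fin 3)).analyticAt _).comp h1
  have hcong : ∀ x, v t x = A (v s (A.symm (x - b))) := by
    have hev : (v t) =ᶠ[𝓝 x₀] fun x => A (v s (A.symm (x - b))) :=
      Filter.eventually_of_mem (hO.mem_nhds hx₀) fun x hx => hcongO x hx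
    have h := (hslice t ht0).eqOn_of_preconnected_of_eventuallyEq hrhs isPreconnected_univ (mem_univ x₀) hev
    exact fun x => h (mem_univ x)
  -- ## (2)+(3) forward propagation ⇒ a uniform bound on `(t, 0) × ℝ³`
  set δ : ℝ := t - s with hδ
  have hδ0 : 0 < δ := by rw [hδ]; linarith
  have hbound : ∀ t' ∈ Ioo t 0, ∀ x, ‖v t' x‖ ≤ |C| / Real.sqrt δ := by
    intro t' ht' x
    have hτs : s < t' - δ := by rw [hδ]; linarith [ht'.1]
    have hτ : t' - δ + (t - s) < 0 := by rw [hδ]; linarith [ht'.2]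
    have h := congruence_propagates hrate hcont hmild hst A b hcong hτs hτ x
    have e : t' - δ + (t - s) = t' := by rw [hδ]; ring
    rw [e] at h
    have hτ0 : t' - δ < 0 := by linarith [ht'.2]
    have hle : Real.sqrt δ ≤ Real.sqrt (-(t' - δ)) := Real.sqrt_le_sqrt (by linarith [ht'.2])
    calc ‖v t' x‖ = ‖v (t' - δ) (A.symm (x - b))‖ := by rw [h]; exact A.norm_map _
      _ ≤ C / Real.sqrt (-(t' - δ)) := hrate _ hτ0 _
      _ ≤ |C| / Real.sqrt (-(t' - δ)) := div_le_div_of_nonneg_right (le_abs_self C) (Real.sqrt_nonneg _)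
      _ ≤ |C| / Real.sqrt δ := div_le_div_of_nonneg_left (abs_nonneg C) (Real.sqrt_pos.2 hδ0) hle
  -- ## (4) the parabolic cylinder `Q_r(0,0)`, `r² = −t`, carries a finite `L^∞` norm
  set r : ℝ := Real.sqrt (-t) with hr
  have hr0 : 0 < r := Real.sqrt_pos.2 (by linarith)
  have hr2 : r ^ 2 = -t := by rw [hr, Real.sq_sqrt (by linarith)]
  have hQ : parabolicCylinder r ((0 : ℝ × EuclideanSpace ℝ (Fin 3))) =
      Ioo t 0 ×ˢ ball (0 : EuclideanSpace ℝ (Fin 3)) r := by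
    simp [parabolicCylinder, hr2]
  have hmeasQ : MeasurableSet (parabolicCylinder r ((0 : ℝ × EuclideanSpace ℝ (Fin 3)))) := by
    rw [hQ]; exact measurableSet_Ioo.prod measurableSet_ball
  have hae : ∀ᵐ p ∂((volume : Measure (ℝ × EuclideanSpace ℝ (Fin 3))).restrict
      (parabolicCylinder r ((0 : ℝ × EuclideanSpace ℝ (Fin 3))))), ‖uncurry v p‖ ≤ |C| / Real.sqrt δ := by
    refine ae_restrict_of_forall_mem hmeasQ fun p hp => ?_
    rw [hQ] at hp
    obtain ⟨hp1, -⟩ := hp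
    exact hbound p.1 hp1 p.2
  have hfin : eLpNorm (uncurry v) ∞ ((volume : Measure (ℝ × EuclideanSpace ℝ (Fin 3))).restrict
      (parabolicCylinder r ((0 : ℝ × EuclideanSpace ℝ (Fin 3))))) < ∞ := by
    rw [eLpNorm_exponent_top]
    exact eLpNormEssSup_lt_top_of_ae_bound hae
  exact hfin.ne (hsing r hr0)

end Summit.NavierStokesRegularity.NavierStokesRegularity.Theorems.PoloidalWindowDoorPoloidalWindowRigidityCongruenceDoor

end
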